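import Summits.ValiantsHypothesis.ValiantsHypothesis.Theorems.BarrierLeverAnchoredDoorHitsLowerPairsDistinctAnchorsSpec
import Summits.ValiantsHypothesis.ValiantsHypothesis.Theorems.BarrierLeverAnchoredDoorHitsLowerPairsStubGenericPoint

/-!
# Support item `AnchoredDoorHitsLowerPairs` (stmt-ValiantsHypothesis-22510), line `anchored-peeling`:
# ISOMORPHIC PAIRS — the permutation member of the anchored door

Helper file (`--supports stmt-ValiantsHypothesis-22510`; cell valiant-natproofs, rung V4, 𝒟-side door (c); registered line
`Cruxes/AnchoredDoorHitsLowerPairs/Lines/anchored_peeling.lean` v10; prover seat val-np-p1 gen 18). One bookkeeping `def` (`isoEval`, a point of the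
parameter space). Closes NO item.

**THEOREM (`symbolicDet_ne_zero_of_perm_layout`, `symbolicDet_ne_zero_of_iso`).** If the column family is the image of the row family under a
permutation `π` of the vertices — `w (τ i) = (u i).image π` for a bijection `τ` of the indices, or equivalently (for injective `u, w`)
`Set.range w = {S.image π : S ∈ Set.range u}` — then `symbolicDet s h r u w ≠ 0` for every profile `s ≥ 1`; NO lower-set hypothesis is needed.
PROOF: evaluate the parameters at the point «`θ_{({a} | {π a})} = 1` for every vertex `a`, every other `θ`, every `φ`, every `ψ` equal to `0`»
(`isoEval`). The witness becomes `∏_a (1 + x_a y_{π a}) = Σ_S x^S y^{π S}` (`map_isoEval_symbolicWitness`, `coeff_permWitness`), whose layout matrix on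
`(u, w)` is the permutation matrix of `τ` (`det ≠ 0`), and evaluation is a ring homomorphism. In the algebraic form of U1 (memo
HOME/val-np-p1/g18/DTS-MEMO-valnp1-g18.md §6) this is the remark that isomorphic pairs are TRIVIAL (the door elements become the monomial basis of
the face algebra); all content of U1 is in non-isomorphic pairs. Covers cube-vs-cube, `∂Δ` vs `∂Δ`, and every relabelled pair at once.

WHAT THIS IS NOT: nothing for non-isomorphic pairs; nothing on items 22510 / 19717 themselves, on crux stmt-ValiantsHypothesis-14610 or on `VP` versus `VNP`.
-/

set_option linter.dupNamespace false

namespace Summit.ValiantsHypothesis.ValiantsHypothesis.Theorems.BarrierLever.AnchoredPeeling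

open Finset MvPolynomial
open Summit.ValiantsHypothesis.ValiantsHypothesis.Theorems.BarrierLever.BrickCalculus (pexpo pexpo_def)

noncomputable section

variable {h : ℕ}

/-- The evaluation point of the permutation member: `θ_{({a}|{π a})} = 1`, all other parameters `0`. -/
def isoEval (π : Equiv.Perm (Fin h)) : Param h → ℂ
  | Sum.inl α => if ∃ a, α = ({a}, {π a}) then 1 else 0
  | Sum.inr _ => 0

/-- The vertex anchor `({a} | {π a})`. -/
theorem vertexAnchor_mem_anchors {s : ℕ} (hs : 1 ≤ s) (π : Equiv.Perm (Fin h)) (a : Fin h) :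
    (({a}, {π a}) : Finset (Fin h) × Finset (Fin h)) ∈ anchors s h := by
  simp only [anchors, Finset.mem_filter, Finset.mem_univ, true_and, Finset.card_singleton]
  omega

/-- Vertex anchors of distinct vertices are distinct. -/
theorem vertexAnchor_injective (π : Equiv.Perm (Fin h)) :
    Function.Injective (fun a : Fin h => (({a}, {π a}) : Finset (Fin h) × Finset (Fin h))) := by
  intro a b hab
  have h1 := congrArg Prod.fst hab
  exact Finset.singleton_injective h1

/-- The tail products evaluate to `1`. -/
theorem map_isoEval_tails (π : Equiv.Perm (Fin h)) (α : Finset (Fin h) × Finset (Fin h)) :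
    MvPolynomial.map (eval (isoEval π))
      ((∏ b ∈ univ \ α.1, (1 + C (X (Sum.inr (Sum.inl (α, b)))) * X (Fin.castAdd h b))) *
       (∏ d ∈ univ \ α.2, (1 + C (X (Sum.inr (Sum.inr (α, d)))) * X (Fin.natAdd h d)))) = 1 := by
  rw [map_mul, map_prod, map_prod]
  have h1 : ∀ b ∈ univ \ α.1, MvPolynomial.map (eval (isoEval π))
      (1 + C (X (Sum.inr (Sum.inl (α, b)))) * X (Fin.castAdd h b) : MvPolynomial (Fin (h + h)) (MvPolynomial (Param h) ℂ)) = 1 := by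
    intro b _
    rw [map_add, map_one, map_mul, map_C, map_X, eval_X, isoEval, C_0, zero_mul, add_zero]
  have h2 : ∀ d ∈ univ \ α.2, MvPolynomial.map (eval (isoEval π))
      (1 + C (X (Sum.inr (Sum.inr (α, d)))) * X (Fin.natAdd h d) : MvPolynomial (Fin (h + h)) (MvPolynomial (Param h) ℂ)) = 1 := by
    intro d _
    rw [map_add, map_one, map_mul, map_C, map_X, eval_X, isoEval, C_0, zero_mul, add_zero]
  rw [Finset.prod_eq_one h1, Finset.prod_eq_one h2, mul_one]

/-- A factor of the witness evaluates to `1 + x_a y_{π a}` at a vertex anchor and to `1` otherwise. -/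
theorem map_isoEval_symbFactor (π : Equiv.Perm (Fin h)) (α : Finset (Fin h) × Finset (Fin h)) :
    MvPolynomial.map (eval (isoEval π)) (symbFactor h α) =
      if ∃ a, α = ({a}, {π a}) then 1 + (∏ a ∈ α.1, X (Fin.castAdd h a)) * (∏ c ∈ α.2, X (Fin.natAdd h c)) else 1 := by
  have htails := map_isoEval_tails π α
  rw [symbFactor, mul_assoc (C (X (Sum.inl α)) * _ * _), map_add, map_one, map_mul, htails, mul_one, map_mul, map_mul, map_C,
    eval_X, map_prod, map_prod]
  simp only [map_X]
  by_cases hα : ∃ a, α = ({a}, {π a})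
  · rw [if_pos hα, isoEval, if_pos hα, C_1, one_mul]
  · rw [if_neg hα, isoEval, if_neg hα, C_0, zero_mul, zero_mul, add_zero]

/-- **The permutation member**: at `isoEval π` the witness is `∏_a (1 + x_a y_{π a})`. -/
theorem map_isoEval_symbolicWitness {s : ℕ} (hs : 1 ≤ s) (π : Equiv.Perm (Fin h)) :
    MvPolynomial.map (eval (isoEval π)) (symbolicWitness s h) =
      ∏ a : Fin h, (1 + X (Fin.castAdd h a) * X (Fin.natAdd h (π a))) := by
  classical
  rw [symbolicWitness_eq_prod, map_prod]
  have hsub : (univ.image fun a : Fin h => (({a}, {π a}) : Finset (Fin h) × Finset (Fin h))) ⊆ anchors s h := by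
    intro α hα
    obtain ⟨a, -, rfl⟩ := Finset.mem_image.mp hα
    exact vertexAnchor_mem_anchors hs π a
  rw [← Finset.prod_subset hsub]
  · rw [Finset.prod_image (fun a _ b _ hab => vertexAnchor_injective π hab)]
    refine Finset.prod_congr rfl (fun a _ => ?_)
    rw [map_isoEval_symbFactor, if_pos ⟨a, rfl⟩, Finset.prod_singleton, Finset.prod_singleton]
  · intro α _ hα
    rw [map_isoEval_symbFactor, if_neg]
    rintro ⟨a, rfl⟩
    exact hα (Finset.mem_image.mpr ⟨a, Finset.mem_univ _, rfl⟩)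

/-- `∏_{a ∈ S} x_a y_{π a}` is the monomial `x^S y^{π S}`. -/
theorem prod_vertexPair_eq_monomial (π : Equiv.Perm (Fin h)) (S : Finset (Fin h)) :
    (∏ a ∈ S, X (Fin.castAdd h a) * X (Fin.natAdd h (π a)) : MvPolynomial (Fin (h + h)) ℂ) = monomial (pexpo S (S.image π)) 1 := by
  classical
  rw [pexpo_def, Finset.sum_image (fun a _ b _ hab => π.injective hab)]
  induction S using Finset.induction_on with
  | empty => simp
  | insert a S ha ih =>
    rw [Finset.prod_insert ha, Finset.sum_insert ha, Finset.sum_insert ha, ih, X, X, monomial_mul, monomial_mul, one_mul, one_mul]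
    congr 1
    abel

/-- The layout entries of the permutation member: `[x^U y^T] ∏_a (1 + x_a y_{π a}) = [T = π U]`. -/
theorem coeff_permWitness (π : Equiv.Perm (Fin h)) (U T : Finset (Fin h)) :
    coeff (pexpo U T) (∏ a : Fin h, (1 + X (Fin.castAdd h a) * X (Fin.natAdd h (π a))) : MvPolynomial (Fin (h + h)) ℂ) =
      if T = U.image π then 1 else 0 := by
  classical
  rw [Finset.prod_one_add, coeff_sum]
  simp_rw [prod_vertexPair_eq_monomial, coeff_monomial]
  by_cases hT : T = U.image π
  · rw [if_pos hT, Finset.sum_eq_single U]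
    · rw [if_pos (by rw [hT])]
    · intro S _ hS
      rw [if_neg]
      intro heq
      exact hS (DistinctAnchors.pexpo_inj heq).1
    · intro hU; exact absurd (Finset.mem_powerset.mpr (Finset.subset_univ U)) hU
  · rw [if_neg hT]
    refine Finset.sum_eq_zero (fun S _ => ?_)
    rw [if_neg]
    intro heq
    obtain ⟨h1, h2⟩ := DistinctAnchors.pexpo_inj heq
    subst h1
    exact hT h2.symm

/-- **Isomorphic layouts are hit (index form).** If `w (τ i) = (u i).image π` for a permutation `π` of the vertices and a bijection `τ` of the
indices (and `w` is injective), then `symbolicDet s h r u w ≠ 0` for every `s ≥ 1`. -/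
theorem symbolicDet_ne_zero_of_perm_layout {s r : ℕ} (hs : 1 ≤ s) (u w : Fin r → Finset (Fin h)) (hw : Function.Injective w)
    (π : Equiv.Perm (Fin h)) (τ : Equiv.Perm (Fin r)) (hτ : ∀ i, w (τ i) = (u i).image π) : symbolicDet s h r u w ≠ 0 := by
  classical
  intro h0
  have hmap := congrArg (eval (isoEval π)) h0
  rw [map_zero, symbolicDet, RingHom.map_det] at hmap
  have hM : (eval (isoEval π)).mapMatrix
      (Matrix.of fun i j : Fin r => coeff (∑ a ∈ u i, Finsupp.single (Fin.castAdd h a) 1 + ∑ c ∈ w j, Finsupp.single (Fin.natAdd h c) 1)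
        (symbolicWitness s h)) = τ.permMatrix ℂ := by
    refine Matrix.ext (fun i j => ?_)
    rw [RingHom.mapMatrix_apply, Matrix.map_apply, Matrix.of_apply, ← pexpo_def, ← coeff_map, map_isoEval_symbolicWitness hs,
      coeff_permWitness, Equiv.Perm.permMatrix, PEquiv.toMatrix_apply, Equiv.toPEquiv_apply]
    simp only [Option.mem_def, Option.some.injEq]
    by_cases hj : τ i = j
    · subst hj; rw [if_pos (hτ i), if_pos rfl]
    · rw [if_neg hj, if_neg]
      intro hw'
      exact hj (hw (by rw [hτ i, hw']))
  rw [hM, Matrix.det_permutation] at hmap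
  rcases Int.units_eq_one_or (Equiv.Perm.sign τ) with h1 | h1 <;> simp [h1] at hmap

/-- **Isomorphic pairs are hit (range form).** Injective `u, w` with `Set.range w = {S.image π : S ∈ Set.range u}` for a vertex permutation `π`:
`symbolicDet s h r u w ≠ 0` for every `s ≥ 1` (no lower-set hypothesis). -/
theorem symbolicDet_ne_zero_of_iso {s r : ℕ} (hs : 1 ≤ s) (u w : Fin r → Finset (Fin h)) (hu : Function.Injective u)
    (hw : Function.Injective w) (π : Equiv.Perm (Fin h)) (hRC : ∀ T, T ∈ Set.range w ↔ ∃ i, (u i).image π = T) :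
    symbolicDet s h r u w ≠ 0 := by
  classical
  have hex : ∀ i, ∃ j, w j = (u i).image π := fun i => by
    obtain ⟨j, hj⟩ := (hRC ((u i).image π)).mpr ⟨i, rfl⟩
    exact ⟨j, hj⟩
  choose f hf using hex
  have hinj : Function.Injective f := by
    intro i i' hii
    have h1 : (u i).image π = (u i').image π := by rw [← hf i, ← hf i', hii]
    exact hu (Finset.image_injective π.injective h1)
  have hbij : Function.Bijective f := hinj.bijective_of_finite
  exact symbolicDet_ne_zero_of_perm_layout hs u w hw π (Equiv.ofBijective f hbij) (fun i => hf i)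

/-- Hence an anchored hit for isomorphic pairs at every profile `s ≥ 1` (the landed `stub_genericPoint`). -/
theorem anchoredHit_of_iso {s r : ℕ} (hs : 1 ≤ s) (u w : Fin r → Finset (Fin h)) (hu : Function.Injective u)
    (hw : Function.Injective w) (π : Equiv.Perm (Fin h)) (hRC : ∀ T, T ∈ Set.range w ↔ ∃ i, (u i).image π = T) :
    AnchoredHit s h r u w :=
  stub_genericPoint s h r u w (symbolicDet_ne_zero_of_iso hs u w hu hw π hRC)

end

end Summit.ValiantsHypothesis.ValiantsHypothesis.Theorems.BarrierLever.AnchoredPeeling
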